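import Mathlib
import HarnessLib
import Summits.MatrixMultiplication.MatrixMultiplication.Theorems.OutsiderSandwichPencilSpanLaw

/-!
# OutsiderSandwich — pencil calculus for powers of the diagonalised CW tensor, III: the pencil law
(decomp-mm lens 4 «minimal-counterexample / extremal reduction», gen 38, kernel K38-2d; THESES-FREE,
DEFINITION-FREE — conventions of Parts I/II)

**Pencil law `PL(N)`** (`pencil_law`): every subspace `U` of covectors on words of length `N` with
`dim U ≥ 3` contains a covector `η` with `2 · rank T_N(η) ≥ 3 · 2^N` — while single covectors and
`2`-dimensional subspaces (e.g. `⟨e_w, e_{w'}⟩` for suitable words) can consist of minrank slices only.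
In the language of the lens: a minimal counterexample to «`cw₂^{⊠N}` packs many matrix multiplications»
is probed by a `3`-space of cheap covectors on the matrix-multiplication side; the pencil law says the
`cw₂` side has no `3`-space of cheap slices, and Part IV turns the mismatch into the packing slack law
`3 · 2^N + 4 B m² ≤ 2m + 4 · 3^N`.

Proof: induction on `N`.  If some letter projection `π_d(U)` has dimension `≥ 3`, use `PL(N)` there and
`rank T_{N+1}(θ) ≥ 2 rank T_N(θ_d)`.  Otherwise (`common_zero_letter`, four points of a line and the
pair lemma of Part II) either some `θ ∈ U` has all components non-zero (`rank ≥ 3 · 2^N`, Part IIc), or a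
letter `a` vanishes on all of `U`; then (`exists_indep_pair`) `U`, having dimension `≥ 3` inside the pairs
`(θ_{a+1}, θ_{a+2})` with both projections of dimension `≤ 2`, contains a `θ` with independent
`θ_{a+1}, θ_{a+2}` (`rank ≥ 3 · 2^N` by the span law, Part IIc).

References: [cite: CoppersmithWinograd1990, §6]; [cite: Roy1995, §1]; [cite: HornJohnson2013, §0.4];
[cite: BlaserIkenmeyerLysikovPandeySchreyer2019, §5].
-/

set_option linter.dupNamespace false

noncomputable section

namespace Summit.MatrixMultiplication.MatrixMultiplication.Theorems.OutsiderSandwichPencilLaw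

open Literature.Computability.AlgebraicComplexity
open Summit.MatrixMultiplication.MatrixMultiplication.Theorems.OutsiderSandwichPencilBlocks
open Summit.MatrixMultiplication.MatrixMultiplication.Theorems.OutsiderSandwichPencilSpan
open Summit.MatrixMultiplication.MatrixMultiplication.Theorems.OutsiderSandwichPencilSpanLaw
open scoped Matrix BigOperators

variable {D : Fin 3 → Fin 3 → Fin 3 → ℂ} {N : ℕ}

/-! ## §1  A common zero letter -/

/-- **Common zero letter.**  If every covector of a subspace `U` has a vanishing component, then one
component vanishes on all of `U` (a vector space over `ℂ` is not a union of three proper subspaces;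
here via the pair lemma `exists_common_zero` at the four scalars `0,1,2,3`). [folklore] -/
theorem common_zero_letter (U : Submodule ℂ ((Fin (N + 1) → Fin 3) → ℂ))
    (h : ∀ θ ∈ U, ∃ d : Fin 3, (fun v : Fin N → Fin 3 => θ (Fin.cons d v)) = 0) :
    ∃ a : Fin 3, ∀ θ ∈ U, (fun v : Fin N → Fin 3 => θ (Fin.cons a v)) = 0 := by
  by_contra hcon
  push Not at hcon
  choose θ hθU hθne using hcon
  have hk : ∀ k : Fin 4, ∃ l : Fin 3,
      (fun v : Fin N → Fin 3 => (θ 0 + ((k : ℕ) : ℂ) • θ 1) (Fin.cons l v)) = 0 ∧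
      (fun v : Fin N → Fin 3 => θ 2 (Fin.cons l v)) = 0 := by
    intro k
    refine exists_common_zero (fun d => fun v : Fin N → Fin 3 => (θ 0 + ((k : ℕ) : ℂ) • θ 1) (Fin.cons d v))
      (fun d => fun v : Fin N → Fin 3 => θ 2 (Fin.cons d v)) ?_
    intro s t _
    obtain ⟨d, hd⟩ := h (s • (θ 0 + ((k : ℕ) : ℂ) • θ 1) + t • θ 2)
      (U.add_mem (U.smul_mem s (U.add_mem (hθU 0) (U.smul_mem _ (hθU 1)))) (U.smul_mem t (hθU 2)))
    exact ⟨d, by rw [← comp_comb]; exact hd⟩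
  choose l hl1 hl2 using hk
  obtain ⟨k, k', hkk', hll⟩ := Fintype.exists_ne_map_eq_of_card_lt l (by simp)
  have e1 := hl1 k
  have e2 := hl1 k'
  rw [← hll] at e2
  have hcast : ((k : ℕ) : ℂ) ≠ ((k' : ℕ) : ℂ) := by
    intro hc
    exact hkk' (Fin.ext (by exact_mod_cast hc))
  have hθ1 : (fun v : Fin N → Fin 3 => θ 1 (Fin.cons (l k) v)) = 0 := by
    have hsub : (((k : ℕ) : ℂ) - ((k' : ℕ) : ℂ)) • (fun v : Fin N → Fin 3 => θ 1 (Fin.cons (l k) v)) = 0 := by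
      have h0 := sub_eq_zero.mpr (e1.trans e2.symm)
      rw [← h0]
      funext v
      simp only [Pi.smul_apply, Pi.sub_apply, Pi.add_apply, smul_eq_mul]
      ring
    exact (smul_eq_zero.mp hsub).resolve_left (sub_ne_zero.mpr hcast)
  have hθ0 : (fun v : Fin N → Fin 3 => θ 0 (Fin.cons (l k) v)) = 0 := by
    funext v
    have h0 := congr_fun e1 v
    have h1 := congr_fun hθ1 v
    simp only [Pi.add_apply, Pi.smul_apply, smul_eq_mul, Pi.zero_apply] at h0 h1 ⊢
    rw [h1, mul_zero, add_zero] at h0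
    exact h0
  have hθ2 := hl2 k
  have hcases : l k = 0 ∨ l k = 1 ∨ l k = 2 := by
    generalize l k = x
    fin_cases x <;> simp
  rcases hcases with hx | hx | hx
  · exact hθne 0 (hx ▸ hθ0)
  · exact hθne 1 (hx ▸ hθ1)
  · exact hθne 2 (hx ▸ hθ2)

/-! ## §2  An independent pair of components -/

/-- **Independent pair.**  Let `a, b, c` be pairwise distinct, `U` a subspace of covectors of
dimension `≥ 3` on which the `a`-component vanishes, and suppose `U` contains non-zero `u¹, u²` with
`u¹_b = 0`, `u²_c = 0`.  Then some `θ ∈ U` has linearly independent components `θ_b, θ_c`.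
[cite: HornJohnson2013, §0.4] -/
theorem exists_indep_pair {a b c : Fin 3} (hab : a ≠ b) (hbc : b ≠ c) (hac : a ≠ c)
    (U : Submodule ℂ ((Fin (N + 1) → Fin 3) → ℂ)) (hU : 3 ≤ Module.finrank ℂ ↥U)
    (hUa : ∀ θ ∈ U, (fun v : Fin N → Fin 3 => θ (Fin.cons a v)) = 0)
    {u₁ u₂ : (Fin (N + 1) → Fin 3) → ℂ} (hu₁ : u₁ ∈ U) (hu₂ : u₂ ∈ U) (hu₁0 : u₁ ≠ 0) (hu₂0 : u₂ ≠ 0)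
    (hu₁b : (fun v : Fin N → Fin 3 => u₁ (Fin.cons b v)) = 0)
    (hu₂c : (fun v : Fin N → Fin 3 => u₂ (Fin.cons c v)) = 0) :
    ∃ θ ∈ U, LinearIndependent ℂ ![(fun v : Fin N → Fin 3 => θ (Fin.cons b v)), (fun v => θ (Fin.cons c v))] := by
  -- every covector with vanishing `a, b, c`-components vanishes
  have hzero : ∀ θ : (Fin (N + 1) → Fin 3) → ℂ, (fun v : Fin N → Fin 3 => θ (Fin.cons a v)) = 0 →
      (fun v : Fin N → Fin 3 => θ (Fin.cons b v)) = 0 → (fun v : Fin N → Fin 3 => θ (Fin.cons c v)) = 0 →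
      θ = 0 := by
    intro θ ha hb hc
    refine eq_zero_of_comp_eq_zero fun d => ?_
    rcases eq_or_ne d a with rfl | hd
    · exact ha
    rcases letter_eq_or _ d _ _ hab hbc hac hd with rfl | rfl
    exacts [hb, hc]
  -- the non-trivial components `ξ := u²_b` and `u¹_c`
  have hξ : (fun v : Fin N → Fin 3 => u₂ (Fin.cons b v)) ≠ 0 :=
    fun h0 => hu₂0 (hzero u₂ (hUa u₂ hu₂) h0 hu₂c)
  have hy₁ : (fun v : Fin N → Fin 3 => u₁ (Fin.cons c v)) ≠ 0 :=
    fun h0 => hu₁0 (hzero u₁ (hUa u₁ hu₁) hu₁b h0)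
  by_cases hind : LinearIndependent ℂ ![(fun v : Fin N → Fin 3 => u₂ (Fin.cons b v)),
    (fun v : Fin N → Fin 3 => u₁ (Fin.cons c v))]
  · refine ⟨u₁ + u₂, U.add_mem hu₁ hu₂, ?_⟩
    have hb' : (fun v : Fin N → Fin 3 => (u₁ + u₂) (Fin.cons b v)) = fun v => u₂ (Fin.cons b v) := by
      funext v; have := congr_fun hu₁b v; simp only [Pi.zero_apply] at this; simp [this]
    have hc' : (fun v : Fin N → Fin 3 => (u₁ + u₂) (Fin.cons c v)) = fun v => u₁ (Fin.cons c v) := by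
      funext v; have := congr_fun hu₂c v; simp only [Pi.zero_apply] at this; simp [this]
    rw [hb', hc']
    exact hind
  -- `u¹_c = lam • ξ` with `lam ≠ 0`
  rw [LinearIndependent.pair_iff' hξ] at hind
  push Not at hind
  obtain ⟨lam, hlam⟩ := hind
  have hlam0 : lam ≠ 0 := by
    rintro rfl; exact hy₁ (by rw [← hlam, zero_smul])
  -- a third vector outside `span {u₁, u₂}`
  classical
  have hspan : ∃ u₃ ∈ U, u₃ ∉ Submodule.span ℂ ((({u₁, u₂} : Finset _) : Set ((Fin (N + 1) → Fin 3) → ℂ))) := by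
    by_contra hcon
    push Not at hcon
    have hle : U ≤ Submodule.span ℂ ((({u₁, u₂} : Finset _) : Set ((Fin (N + 1) → Fin 3) → ℂ))) := hcon
    have h1 := Submodule.finrank_mono hle
    have h2 : Module.finrank ℂ ↥(Submodule.span ℂ ((({u₁, u₂} : Finset _) : Set ((Fin (N + 1) → Fin 3) → ℂ)))) ≤ 2 :=
      (finrank_span_finset_le_card _).trans ((Finset.card_insert_le _ _).trans (by simp))
    omega
  obtain ⟨u₃, hu₃, hu₃s⟩ := hspan
  rw [Finset.coe_pair, Submodule.mem_span_pair] at hu₃s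
  -- components are linear
  have hlin : ∀ (θ θ' : (Fin (N + 1) → Fin 3) → ℂ) (s : ℂ) (d : Fin 3),
      (fun v : Fin N → Fin 3 => (θ + s • θ') (Fin.cons d v)) =
        (fun v => θ (Fin.cons d v)) + s • (fun v => θ' (Fin.cons d v)) := fun _ _ _ _ => rfl
  by_cases hx : LinearIndependent ℂ ![(fun v : Fin N → Fin 3 => u₂ (Fin.cons b v)),
    (fun v : Fin N → Fin 3 => u₃ (Fin.cons b v))]
  · -- (i) `u³_b ∉ ℂ ξ`: `u³` or `u³ + u¹` works
    by_cases h0 : LinearIndependent ℂ ![(fun v : Fin N → Fin 3 => u₃ (Fin.cons b v)),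
      (fun v : Fin N → Fin 3 => u₃ (Fin.cons c v))]
    · exact ⟨u₃, hu₃, h0⟩
    by_cases h1 : LinearIndependent ℂ ![(fun v : Fin N → Fin 3 => (u₃ + (1 : ℂ) • u₁) (Fin.cons b v)),
      (fun v : Fin N → Fin 3 => (u₃ + (1 : ℂ) • u₁) (Fin.cons c v))]
    · exact ⟨u₃ + (1 : ℂ) • u₁, U.add_mem hu₃ (U.smul_mem _ hu₁), h1⟩
    exfalso
    rw [hlin, hlin, hu₁b, smul_zero, add_zero, ← hlam, one_smul] at h1
    have hx0 : (fun v : Fin N → Fin 3 => u₃ (Fin.cons b v)) ≠ 0 := by simpa using hx.ne_zero 1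
    rw [LinearIndependent.pair_iff' hx0] at h0 h1
    push Not at h0 h1
    obtain ⟨μ₀, hμ₀⟩ := h0
    obtain ⟨μ₁, hμ₁⟩ := h1
    have hrel : lam • (fun v : Fin N → Fin 3 => u₂ (Fin.cons b v)) +
        (μ₀ - μ₁) • (fun v : Fin N → Fin 3 => u₃ (Fin.cons b v)) = 0 := by
      rw [sub_smul, hμ₀, hμ₁]; abel
    exact hlam0 ((LinearIndependent.pair_iff.mp hx) _ _ hrel).1
  · -- (ii) `u³_b = μ ξ`: replace `u³` by `u⁴ = u³ - μ u²` (`u⁴_b = 0`, `u⁴_c = u³_c`)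
    rw [LinearIndependent.pair_iff' hξ] at hx
    push Not at hx
    obtain ⟨μ, hμ⟩ := hx
    have hu₄U : u₃ + (-μ) • u₂ ∈ U := U.add_mem hu₃ (U.smul_mem _ hu₂)
    have hu₄b : (fun v : Fin N → Fin 3 => (u₃ + (-μ) • u₂) (Fin.cons b v)) = 0 := by
      rw [hlin, ← hμ, neg_smul, add_neg_cancel]
    have hu₄c : (fun v : Fin N → Fin 3 => (u₃ + (-μ) • u₂) (Fin.cons c v)) = fun v => u₃ (Fin.cons c v) := by
      rw [hlin, hu₂c, smul_zero, add_zero]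
    by_cases hy : LinearIndependent ℂ ![(fun v : Fin N → Fin 3 => u₂ (Fin.cons b v)),
      (fun v : Fin N → Fin 3 => u₃ (Fin.cons c v))]
    · refine ⟨u₃ + (-μ) • u₂ + (1 : ℂ) • u₂, U.add_mem hu₄U (U.smul_mem _ hu₂), ?_⟩
      rw [hlin, hu₄b, hlin, hu₄c, hu₂c]
      simpa only [one_smul, zero_add, smul_zero, add_zero] using hy
    exfalso
    rw [LinearIndependent.pair_iff' hξ] at hy
    push Not at hy
    obtain ⟨ν, hν⟩ := hy
    have hc' : -(ν / lam) * lam = -ν := by field_simp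
    have h4 : u₃ + (-μ) • u₂ = (ν / lam) • u₁ := by
      rw [← sub_eq_zero, sub_eq_add_neg, ← neg_smul]
      refine hzero _ ?_ ?_ ?_
      · rw [hlin, hUa _ hu₄U, hUa _ hu₁, smul_zero, add_zero]
      · rw [hlin, hu₄b, hu₁b, smul_zero, add_zero]
      · rw [hlin, hu₄c, ← hlam, ← hν, smul_smul, hc', ← add_smul, add_neg_cancel, zero_smul]
    apply hu₃s
    refine ⟨ν / lam, μ, ?_⟩
    rw [← h4, neg_smul, neg_add_cancel_right]

/-! ## §3  The pencil law -/

/-- **Pencil law** for the diagonalised Coppersmith–Winograd tensor: every subspace of covectors of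
dimension `≥ 3` contains `η` with `2 · rank T_N(η) ≥ 3 · 2^N`. [cite: CoppersmithWinograd1990, §6] -/
theorem pencil_law (hD : ∀ a b c, D a b c = if a ≠ b ∧ b ≠ c ∧ a ≠ c then 1 else 0) :
    ∀ (N : ℕ) (U : Submodule ℂ ((Fin N → Fin 3) → ℂ)), 3 ≤ Module.finrank ℂ ↥U →
      ∃ η ∈ U, 3 * 2 ^ N ≤ 2 * (contract3 (kroneckerPow D N) η).rank := by
  intro N
  induction N with
  | zero =>
    intro U hU
    exfalso
    have h := Submodule.finrank_le U
    simp at h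
    omega
  | succ N ih =>
    intro U hU
    have hpow : 2 ^ (N + 1) = 2 * 2 ^ N := by ring
    by_cases h1 : ∃ d : Fin 3, 3 ≤ Module.finrank ℂ
      ↥(U.map (LinearMap.funLeft ℂ ℂ (fun v : Fin N → Fin 3 => (Fin.cons d v : Fin (N + 1) → Fin 3))))
    · -- a letter projection of dimension `≥ 3`
      obtain ⟨d, hd⟩ := h1
      obtain ⟨η', hη', hr⟩ := ih _ hd
      obtain ⟨θ, hθU, hθη⟩ := Submodule.mem_map.mp hη'
      refine ⟨θ, hθU, ?_⟩
      have hcomp : (fun v : Fin N → Fin 3 => θ (Fin.cons d v)) = η' := by rw [← hθη]; rfl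
      have h2 := two_mul_rank_comp_le hD N θ d
      rw [hcomp] at h2
      omega
    push Not at h1
    by_cases h2 : ∃ θ ∈ U, ∀ d : Fin 3, (fun v : Fin N → Fin 3 => θ (Fin.cons d v)) ≠ 0
    · -- a covector with three non-zero components
      obtain ⟨θ, hθU, hθ⟩ := h2
      exact ⟨θ, hθU, by have := three_two_pow_le_rank_of_comps hD N θ hθ; omega⟩
    push Not at h2
    -- a letter `a` vanishing on `U`, and an independent pair of the remaining components
    obtain ⟨a, hUa⟩ := common_zero_letter U h2
    obtain ⟨hab, hbc, hac⟩ := succ_letters a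
    have hker : ∀ d : Fin 3, ∃ u ∈ U, u ≠ 0 ∧ (fun v : Fin N → Fin 3 => u (Fin.cons d v)) = 0 := by
      intro d
      have hlt := h1 d
      set π := LinearMap.funLeft ℂ ℂ (fun v : Fin N → Fin 3 => (Fin.cons d v : Fin (N + 1) → Fin 3)) with hπ
      have hrn := LinearMap.finrank_range_add_finrank_ker (π.domRestrict U)
      rw [LinearMap.range_domRestrict] at hrn
      have hk : LinearMap.ker (π.domRestrict U) ≠ ⊥ := by
        intro hb
        rw [hb, finrank_bot] at hrn
        omega
      obtain ⟨w, hw, hw0⟩ := (Submodule.ne_bot_iff _).mp hk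
      refine ⟨w, w.2, fun h0 => hw0 (Subtype.ext h0), ?_⟩
      rw [LinearMap.mem_ker, LinearMap.domRestrict_apply] at hw
      rw [← hw]
      rfl
    obtain ⟨u₁, hu₁, hu₁0, hu₁b⟩ := hker (a + 1)
    obtain ⟨u₂, hu₂, hu₂0, hu₂c⟩ := hker (a + 2)
    obtain ⟨θ, hθU, hind⟩ := exists_indep_pair hab hbc hac U hU hUa hu₁ hu₂ hu₁0 hu₂0 hu₁b hu₂c
    exact ⟨θ, hθU, by have := three_two_pow_le_rank_of_pair hD N θ hab hbc hac hind; omega⟩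

end Summit.MatrixMultiplication.MatrixMultiplication.Theorems.OutsiderSandwichPencilLaw
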